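import Mathlib
import Literature.Analysis.FluidPDE.ClassicalSolution
import Literature.Analysis.FluidPDE.LerayHopf
import Literature.Analysis.FluidPDE.NSWave0
import Literature.Analysis.FluidPDE.NSSereginEnergyApproximants
import Literature.Analysis.FluidPDE.NSCriticalClosureBesovBounded
import Literature.Analysis.FluidPDE.TaoLocalisationHolds
import Literature.Analysis.FluidPDE.KNSSTypeIIHolds
import Literature.Analysis.FluidPDE.BarkerPrangeConcentrationProofs
import Summits.NavierStokesRegularity.NavierStokesRegularity.Theses.L3TimeExponentPincer
import Summits.NavierStokesRegularity.NavierStokesRegularity.Theorems.L3TimeExponentPincerEffNode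
import Summits.NavierStokesRegularity.NavierStokesRegularity.Theorems.L3TimeExponentPincerPaceDichotomy
import Summits.NavierStokesRegularity.NavierStokesRegularity.Theorems.L3TimeExponentPincerSmallUlocDatumRegularity
import Summits.NavierStokesRegularity.NavierStokesRegularity.Theorems.TypeICertificateLadderTypeIConcentration
import HarnessLib.Audit
import HarnessLib

/-!
# Stub 1 of line `pace` (crux `EffSatBlowup`, route `L3TimeExponentPincer`) — PROVED:
# every frame blow-up concentrates `L²` energy in parabolic balls (Kang–Miura–Tsai 2021 Thm 1.6 (i))

Support file for `stmt-NavierStokesRegularity-19139` (`EffSatBlowup`, hard child of `L3CascadeJaw`;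
cell ns-regularity-ideate, seat p4).  The registered M-stub `stub_parabolicConcentration_blowup` of the
skeleton `line `pace`` (planner p2, ROUND-8; stubs `stub_parabolicConcentration_blowup` /
`stub_morreyTypeI_slow` / `stub_morreyTypeII_fastFat`, composition `EffSatBlowup_proof`) is proved BY NAME and
with its registered signature, UNCONDITIONALLY (0 `sorry`, no named-fact hypothesis):

* `Cruxes.EffSatBlowup.Pace.stub_parabolicConcentration_blowup` — in the route's Leray–Hopf frame
  (classical solution on `[0,T)`, Leray–Hopf from a rapidly decaying datum), a solution with NO smooth
  extension past `T` satisfies `ParabolicConcentration u T`: there are `γ, c > 0` with, for EVERY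
  `t ∈ (0, T)`, a centre `x₀` such that `γ √(T-t) ≤ ∫_{B(x₀, c√(T-t))} |u(t)|²`
  (here `c = √(ν/S)`, `γ = γ₁ ν² c` with the absolute `γ₁, S` of the helper file).

This is the statement of Kang–Miura–Tsai, Pure Appl. Anal. 3 (2021) = arXiv:2006.13145, **Thm 1.6 (i)**
(= Bradshaw–Tsai 2020), for the frame, and the proof is theirs (§4.2, p. 12): if at some time `t` every
ball of radius `λ = √(ν(T-t)/S)` carried energy `< γ√(T-t)`, then Seregin's rescaled restart
`U(s,y) = (λ/ν) u(t + (λ²/ν)s, x₁ + λy)` (tree: `IsLerayHopfOn.exists_isLocalEnergySolutionOn_rescaled_restart`,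
a unit-viscosity local energy solution on the strip `(0, S)` ending exactly at the rescaled blow-up time)
would have unit-ball energies `< γ₁` at every centre, so by the small-`L²_uloc`-datum regularity theorem
(`Theorems.L3TimeExponentPincerSmallUlocDatumRegularity.exists_ae_bound_top_of_small_uloc_energy`:
Jia–Šverák a priori estimate + Caffarelli–Kohn–Nirenberg at one scale, vertex on the top of the strip)
`|U| ≤ K` a.e. on `Q_{√S/2}(S, 0)`; transporting back (`eLpNorm_top_uncurry_smul_stPull_preimage`) and
varying the centre `x₁`, `u` is essentially — hence, being classical, pointwise — bounded by `Kν/λ` on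
`(T - (T-t)/4, T) × ℝ³`; with Tao's closed-slab bound on `[0, T - (T-t)/4]`
(`exists_forall_norm_le_of_tao2011 tao2011_hasBoundedSobolevNormsOn_holds`) the solution is bounded on
`[0, T) × ℝ³`, so it extends smoothly past `T` (Robinson–Rodrigo–Sadowski Thm 8.17,
`hasSmoothExtensionPast_of_bounded_holds`) — contradiction.

Consequences recorded here (all unconditional now): `parabolicConcentrationB_holds` (the node
`ParabolicConcentrationB` of `Theorems.L3TimeExponentPincerPaceDichotomy`, tagged `@[conjecture]` there only
for want of this transcription, HOLDS); `effSatNear_of_blowup_of_l3Slow` (EVERY `L³`-slow frame blow-up —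
`‖u(t)‖₃³ ≤ A/√(T-t)` — satisfies the crux clause `K₃(1)`, strictly beyond the sup-Type-I rung);
`effSatBlowup_iff_fastTimesFatB'` (the crux IS its restriction to `L³`-fast times) and
`effSatBlowupMTI_iff_morreyTypeISlowB'` (on the Morrey-Type-I class the crux IS the rate statement
`MorreyTypeISlowB`); `morreyTypeINear_of_typeI` (the Morrey-Type-I class of stub 2 CONTAINS every sup-Type-I frame
blow-up — Barker–Prange 2020 p. 5 / Seregin–Zajączkowski — by the tree's uniform Morrey bound
`scaledEnergyBound_proof`, so stub 2 is decided TRUE on that sub-class by `l3Slow_of_typeI`).  With stub 1 a theorem, the registered composition `EffSatBlowup_proof` of line `pace`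
closes the crux from its two remaining stubs (`stub_morreyTypeI_slow`, `stub_morreyTypeII_fastFat`).

WHAT THIS IS NOT: not a claim about Navier–Stokes regularity or blow-up; an implication between typed tree
predicates, kernel-checked, landed `--supports`; the crux `EffSatBlowup` stays open (stubs 2 and 3).
-/

noncomputable section

open MeasureTheory Set Function Filter Metric Topology TopologicalSpace
open scoped ENNReal NNReal
open Literature.Analysis.FluidPDE
open Summit.NavierStokesRegularity.NavierStokesRegularity.Theorems.L3TimeExponentPincerEffNode
open Summit.NavierStokesRegularity.NavierStokesRegularity.Theorems.L3TimeExponentPincerPaceDichotomy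
open Summit.NavierStokesRegularity.NavierStokesRegularity.Theorems.L3TimeExponentPincerSmallUlocDatumRegularity

namespace Summit.NavierStokesRegularity.NavierStokesRegularity.Theorems.L3TimeExponentPincerStubParabolicConcentration

/-- A field continuous on an open set of space–time and a.e. bounded there is bounded there (Lebesgue
measure charges open sets). [folklore] -/
theorem norm_le_of_ae_bound_of_continuousOn {O : Set (ℝ × EuclideanSpace ℝ (Fin 3))} (hO : IsOpen O)
    {f : ℝ × EuclideanSpace ℝ (Fin 3) → EuclideanSpace ℝ (Fin 3)} (hf : ContinuousOn f O) {M : ℝ}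
    (hae : ∀ᵐ z ∂(volume.restrict O), ‖f z‖ ≤ M) : ∀ w ∈ O, ‖f w‖ ≤ M := by
  intro w hw
  by_contra hlt
  rw [not_le] at hlt
  set N : Set (ℝ × EuclideanSpace ℝ (Fin 3)) := O ∩ (fun z => ‖f z‖) ⁻¹' Ioi M with hN
  have hNopen : IsOpen N := hf.norm.isOpen_inter_preimage hO isOpen_Ioi
  have hNpos : 0 < volume N := hNopen.measure_pos volume ⟨w, hw, hlt⟩
  have hNzero : volume N = 0 := by
    have h1 : ∀ᵐ z ∂(volume : Measure (ℝ × EuclideanSpace ℝ (Fin 3))), z ∈ O → ‖f z‖ ≤ M :=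
      (ae_restrict_iff' hO.measurableSet).1 hae
    refine measure_mono_null (fun z hzN => ?_) (ae_iff.1 h1)
    intro hz
    exact (hz hzN.1).not_gt hzN.2
  exact hNpos.ne' hNzero

/-- **Boundedness on closed sub-strips** of a frame solution, in the `L^∞` currency of
`IsRegularPoint` (Tao 2013, closed-slab bounds: `exists_forall_norm_le_of_tao2011`). -/
theorem eLpNorm_top_Icc_lt_top_of_frame {ν T : ℝ} (hν : 0 < ν)
    {u : ℝ → EuclideanSpace ℝ (Fin 3) → EuclideanSpace ℝ (Fin 3)} {p : ℝ → EuclideanSpace ℝ (Fin 3) → ℝ}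
    (hcl : IsClassicalNSSolutionOn (Ico 0 T) ν 0 u p) (hLH : IsLerayHopfOn T ν 0 (u 0) u)
    (hdec : HasRapidSpatialDecay (u 0)) :
    ∀ T' ∈ Ioo 0 T, eLpNorm (uncurry u) ∞ (volume.restrict (Icc 0 T' ×ˢ univ)) < ∞ := by
  intro T' hT'
  obtain ⟨M, hM⟩ := exists_forall_norm_le_of_tao2011 tao2011_hasBoundedSobolevNormsOn_holds hν hcl hLH
    hdec T' hT'
  rw [eLpNorm_exponent_top]
  exact eLpNormEssSup_lt_top_of_ae_bound (C := M)
    ((ae_restrict_mem (measurableSet_Icc.prod MeasurableSet.univ)).mono fun z hz => hM z.1 hz.1 z.2)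

end Summit.NavierStokesRegularity.NavierStokesRegularity.Theorems.L3TimeExponentPincerStubParabolicConcentration

namespace Summit.NavierStokesRegularity.NavierStokesRegularity.Cruxes.EffSatBlowup.Pace

open Summit.NavierStokesRegularity.NavierStokesRegularity.Theorems.L3TimeExponentPincerStubParabolicConcentration

/-- **Registered stub `stub_parabolicConcentration_blowup` of line `pace` (PROVED) — parabolic `L²`
concentration on the blow-up branch** (Kang–Miura–Tsai 2021 Thm 1.6 (i) = Bradshaw–Tsai 2020, for the
route's frame).  Every classical solution on `[0,T)`, Leray–Hopf from a rapidly decaying datum, with no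
smooth extension past `T`, has `γ √(T-t) ≤ ∫_{B(x₀(t), c√(T-t))} |u(t)|²` for some centre `x₀(t)`, at
EVERY `t ∈ (0,T)`, with `c = √(ν/S)`, `γ = γ₁ν²c` (`γ₁, S` absolute).  Proof: the module docstring
(rescaled restart as a local energy solution on `(0,S)`, small-`L²_uloc`-datum regularity at the top of the
strip, transport back, closed-slab bounds, continuation of bounded Leray–Hopf solutions).
[cite: KangMiuraTsai2021PAA, Thm 1.6 (i) and its proof §4.2 (arXiv:2006.13145 pp. 5, 12)] -/
theorem stub_parabolicConcentration_blowup :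
    ∀ (ν T : ℝ), 0 < ν → 0 < T →
      ∀ (u : ℝ → EuclideanSpace ℝ (Fin 3) → EuclideanSpace ℝ (Fin 3)) (p : ℝ → EuclideanSpace ℝ (Fin 3) → ℝ),
        IsClassicalNSSolutionOn (Ico 0 T) ν 0 u p → IsLerayHopfOn T ν 0 (u 0) u →
        HasRapidSpatialDecay (u 0) → ¬ HasSmoothExtensionPast ν 0 u T → ParabolicConcentration u T := by
  intro ν T hν hT u p hcl hLH hdec hnext
  obtain ⟨γ₁, hγ₁, S, hS, -, K, hK0, hA⟩ := exists_ae_bound_top_of_small_uloc_energy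
  -- interior regularity of the frame solution
  have hreg : ∀ t ∈ Ioo 0 T, ∀ x : EuclideanSpace ℝ (Fin 3), IsRegularPoint u (t, x) := fun t ht x =>
    isRegularPoint_of_eLpNorm_Icc_lt_top (eLpNorm_top_Icc_lt_top_of_frame hν hcl hLH hdec) ht x
  have hνS : 0 < ν / S := div_pos hν hS
  set c : ℝ := Real.sqrt (ν / S) with hc
  have hcpos : 0 < c := Real.sqrt_pos.2 hνS
  refine ⟨γ₁ * ν ^ 2 * c, by positivity, c, hcpos, 0, hT, fun t ht => ?_⟩
  by_contra hcon
  push Not at hcon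
  -- ### the scale `λ = √(ν(T-t)/S)` and the late window `(t₁, T)`, `t₁ = t + 3(T-t)/4`
  have hs : 0 < T - t := sub_pos.2 ht.2
  obtain ⟨lam, hlam_def, hlam, hlam2⟩ :
      ∃ lam : ℝ, lam = Real.sqrt (ν * (T - t) / S) ∧ 0 < lam ∧ lam ^ 2 = ν * (T - t) / S :=
    ⟨_, rfl, Real.sqrt_pos.2 (by positivity), Real.sq_sqrt (by positivity)⟩
  have hlam0 : lam ≠ 0 := hlam.ne'
  have hν0 : ν ≠ 0 := hν.ne'
  have hS0 : S ≠ 0 := hS.ne'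
  have hs0 : T - t ≠ 0 := hs.ne'
  have hclam : c * Real.sqrt (T - t) = lam := by
    rw [hc, hlam_def, ← Real.sqrt_mul hνS.le]
    congr 1
    field_simp
  have hstrip : ν * (T - t) / lam ^ 2 = S := by
    rw [hlam2]
    field_simp
  have hβ : 0 < lam ^ 2 / ν := by positivity
  have hsqS : (Real.sqrt S / 2) ^ 2 = S / 4 := by
    rw [div_pow, Real.sq_sqrt hS.le]; norm_num
  set t₁ : ℝ := t + 3 * (T - t) / 4 with ht₁
  have ht₁pos : 0 < t₁ := by rw [ht₁]; linarith [ht.1]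
  have ht₁T : t₁ < T := by rw [ht₁]; linarith
  have hcyl_eq : parabolicCylinder (Real.sqrt S / 2) ((S : ℝ), (0 : EuclideanSpace ℝ (Fin 3))) =
      Ioo (S - (Real.sqrt S / 2) ^ 2) S ×ˢ ball (0 : EuclideanSpace ℝ (Fin 3)) (Real.sqrt S / 2) := rfl
  -- ### the bound on the late window, ball by ball
  have hwin : ∀ x₁ : EuclideanSpace ℝ (Fin 3),
      ∀ z ∈ Ioo t₁ T ×ˢ ball x₁ (lam * (Real.sqrt S / 2)), ‖uncurry u z‖ ≤ K * ν / lam := by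
    intro x₁
    set Sx : Set (ℝ × EuclideanSpace ℝ (Fin 3)) := Ioo t₁ T ×ˢ ball x₁ (lam * (Real.sqrt S / 2)) with hSx
    -- Seregin's rescaled restart at `t`, centre `x₁`, scale `λ`: a local energy solution on `(0, S)`
    obtain ⟨π, hU⟩ := hLH.exists_isLocalEnergySolutionOn_rescaled_restart hν hT hreg ht hlam x₁
    rw [hstrip] at hU
    have e3 : (fun s y => (lam / ν) • u (t + lam ^ 2 / ν * s) (x₁ + lam • y)) =
        (lam / ν) • stPull (lam ^ 2 / ν) lam t x₁ u := by
      funext s y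
      rw [smul_stPull_apply]
    rw [e3] at hU
    -- the datum: measurable, with unit-ball energies `< γ₁` at every centre
    have hcont_t : Continuous (u t) := (hcl.contDiff_velocity ⟨ht.1.le, ht.2⟩).continuous
    have hU₀m : AEStronglyMeasurable (fun y => (lam / ν) • u t (x₁ + lam • y)) volume := by
      have h1 : Continuous fun y : EuclideanSpace ℝ (Fin 3) => x₁ + lam • y := by fun_prop
      exact ((hcont_t.comp h1).const_smul (lam / ν)).aestronglyMeasurable
    have hq : 0 ≤ lam / ν := by positivity
    have hU₀small : ∀ x₀ : EuclideanSpace ℝ (Fin 3),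
        ∫⁻ y in ball x₀ 1, ‖(lam / ν) • u t (x₁ + lam • y)‖ₑ ^ 2 ≤ ENNReal.ofReal γ₁ := by
      intro x₀
      have e1 : ∀ y : EuclideanSpace ℝ (Fin 3), ‖(lam / ν) • u t (x₁ + lam • y)‖ₑ ^ 2 =
          ENNReal.ofReal (lam / ν) ^ 2 * ‖u t (x₁ + lam • y)‖ₑ ^ 2 := fun y => by
        rw [enorm_smul, mul_pow, Real.enorm_eq_ofReal hq]
      simp_rw [e1]
      rw [lintegral_const_mul' _ _ (ENNReal.pow_ne_top ENNReal.ofReal_ne_top)]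
      have e2 : ball x₀ 1 = (fun y : EuclideanSpace ℝ (Fin 3) => x₁ + lam • y) ⁻¹'
          ball (x₁ + lam • x₀) (lam * 1) := (space_affine_preimage_ball_add_smul hlam x₁ x₀ 1).symm
      rw [e2, setLIntegral_preimage_comp_space_affine hlam x₁ (fun z => ‖u t z‖ₑ ^ 2)
        (ball (x₁ + lam • x₀) (lam * 1)), finrank_euclideanSpace_fin, mul_one]
      have hI : ∫⁻ z in ball (x₁ + lam • x₀) lam, ‖u t z‖ₑ ^ 2 ≤ ENNReal.ofReal (γ₁ * ν ^ 2 * lam) := by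
        have h := hcon (x₁ + lam • x₀)
        rw [hclam, mul_assoc (γ₁ * ν ^ 2) c (Real.sqrt (T - t)), hclam] at h
        exact h.le
      calc ENNReal.ofReal (lam / ν) ^ 2 *
            (ENNReal.ofReal (lam ^ 3)⁻¹ * ∫⁻ z in ball (x₁ + lam • x₀) lam, ‖u t z‖ₑ ^ 2)
          ≤ ENNReal.ofReal (lam / ν) ^ 2 *
              (ENNReal.ofReal (lam ^ 3)⁻¹ * ENNReal.ofReal (γ₁ * ν ^ 2 * lam)) := by gcongr
        _ = ENNReal.ofReal ((lam / ν) ^ 2 * ((lam ^ 3)⁻¹ * (γ₁ * ν ^ 2 * lam))) := by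
            rw [← ENNReal.ofReal_pow hq, ← ENNReal.ofReal_mul (by positivity),
              ← ENNReal.ofReal_mul (by positivity)]
        _ = ENNReal.ofReal γ₁ := by
            congr 1
            field_simp

    -- the small-datum regularity theorem: `|U| ≤ K` a.e. on `Q_{√S/2}(S, 0)`
    have hae := hA _ _ π hU₀m hU hU₀small
    -- `Q_{√S/2}(S, 0)` is the preimage of the late cylinder `(t₁, T) × B(x₁, λ√S/2)`
    have hpre : stAffine (lam ^ 2 / ν) lam t x₁ ⁻¹' Sx =
        parabolicCylinder (Real.sqrt S / 2) ((S : ℝ), (0 : EuclideanSpace ℝ (Fin 3))) := by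
      rw [hcyl_eq, hSx, stAffine_preimage_cylinder hβ hlam, sub_self, smul_zero]
      have e1 : (t₁ - t) / (lam ^ 2 / ν) = S - (Real.sqrt S / 2) ^ 2 := by
        rw [hsqS, ht₁, hlam2]
        field_simp
        ring
      have e2 : (T - t) / (lam ^ 2 / ν) = S := by
        rw [hlam2]
        field_simp
      have e4 : lam * (Real.sqrt S / 2) / lam = Real.sqrt S / 2 := by
        field_simp
      rw [e1, e2, e4]
    have h1 : eLpNorm (uncurry ((lam / ν) • stPull (lam ^ 2 / ν) lam t x₁ u)) ∞
        (volume.restrict (stAffine (lam ^ 2 / ν) lam t x₁ ⁻¹' Sx)) ≤ ENNReal.ofReal K := by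
      rw [hpre, eLpNorm_exponent_top]
      exact eLpNormEssSup_le_of_ae_bound hae
    rw [eLpNorm_top_uncurry_smul_stPull_preimage hβ hlam t x₁ (lam / ν) u Sx] at h1
    have hq' : 0 < lam / ν := by positivity
    have h2 : eLpNorm (uncurry u) ∞ (volume.restrict Sx) ≤ ENNReal.ofReal (K * ν / lam) := by
      rw [show K * ν / lam = K / (lam / ν) by field_simp, ENNReal.ofReal_div_of_pos hq',
        ENNReal.le_div_iff_mul_le (Or.inl (ENNReal.ofReal_pos.2 hq').ne') (Or.inl ENNReal.ofReal_ne_top),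
        mul_comm]
      rwa [Real.enorm_eq_ofReal hq] at h1
    have h3 : ∀ᵐ z ∂(volume.restrict Sx), ‖uncurry u z‖ ≤ K * ν / lam := by
      rw [eLpNorm_exponent_top] at h2
      filter_upwards [ae_le_eLpNormEssSup (f := uncurry u) (μ := volume.restrict Sx)] with z hz
      have hz' : ENNReal.ofReal ‖uncurry u z‖ ≤ ENNReal.ofReal (K * ν / lam) := by
        rw [ofReal_norm]
        exact hz.trans h2
      exact (ENNReal.ofReal_le_ofReal_iff (by positivity)).1 hz'
    -- the classical solution is continuous on the (open) late cylinder
    have hopen : IsOpen Sx := isOpen_Ioo.prod isOpen_ball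
    have hcontS : ContinuousOn (uncurry u) Sx := by
      refine hcl.smooth_velocity.continuousOn.mono (prod_mono (fun τ hτ => ?_) (subset_univ _))
      exact ⟨(ht₁pos.trans hτ.1).le, hτ.2⟩
    exact norm_le_of_ae_bound_of_continuousOn hopen hcontS h3
  -- ### `u` is bounded on `[0, T) × ℝ³`, hence extends past `T`: contradiction
  have hlate : ∀ τ ∈ Ioo t₁ T, ∀ x : EuclideanSpace ℝ (Fin 3), ‖u τ x‖ ≤ K * ν / lam :=
    fun τ hτ x => hwin x (τ, x) ⟨hτ, mem_ball_self (by positivity)⟩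
  obtain ⟨M₁, hM₁⟩ := exists_forall_norm_le_of_tao2011 tao2011_hasBoundedSobolevNormsOn_holds hν hcl hLH
    hdec t₁ ⟨ht₁pos, ht₁T⟩
  refine hnext (hasSmoothExtensionPast_of_bounded_holds hν hT hcl hLH ⟨max M₁ (K * ν / lam), ?_⟩)
  intro τ hτ x
  rcases le_or_gt τ t₁ with h | h
  · exact (hM₁ τ ⟨hτ.1, h⟩ x).trans (le_max_left _ _)
  · exact (hlate τ ⟨h, hτ.2⟩ x).trans (le_max_right _ _)

end Summit.NavierStokesRegularity.NavierStokesRegularity.Cruxes.EffSatBlowup.Pace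

namespace Summit.NavierStokesRegularity.NavierStokesRegularity.Theorems.L3TimeExponentPincerStubParabolicConcentration

open Summit.NavierStokesRegularity.NavierStokesRegularity.Cruxes.EffSatBlowup.Pace

/-- **The node `ParabolicConcentrationB` HOLDS** (it was tagged `@[conjecture]` in
`Theorems.L3TimeExponentPincerPaceDichotomy` only for want of this proof): every frame blow-up concentrates
`L²` energy parabolically.  Definitionally the registered stub. -/
theorem parabolicConcentrationB_holds : ParabolicConcentrationB :=
  stub_parabolicConcentration_blowup

/-- **Every `L³`-slow frame blow-up satisfies the crux clause `K₃(1)`**, unconditionally: a frame solution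
with no smooth extension past `T` and `‖u(t)‖₃³ ≤ A/√(T-t)` on a final window (`L3Slow`, the `L³`-Type-I
pace — strictly wider than the sup-Type-I regime of `Theorems.L3TimeExponentPincerTypeIRung`) satisfies
`EffSatNear u T` (the slow slice `effSatNear_of_parabolic_of_slow` fed with the proved stub). -/
theorem effSatNear_of_blowup_of_l3Slow {ν T : ℝ} (hν : 0 < ν) (hT : 0 < T)
    {u : ℝ → EuclideanSpace ℝ (Fin 3) → EuclideanSpace ℝ (Fin 3)} {p : ℝ → EuclideanSpace ℝ (Fin 3) → ℝ}
    (hcl : IsClassicalNSSolutionOn (Ico 0 T) ν 0 u p) (hLH : IsLerayHopfOn T ν 0 (u 0) u)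
    (hdec : HasRapidSpatialDecay (u 0)) (hnext : ¬ HasSmoothExtensionPast ν 0 u T) (hslow : L3Slow u T) :
    EffSatNear u T :=
  effSatNear_of_parabolic_of_slow (stub_parabolicConcentration_blowup ν T hν hT u p hcl hLH hdec hnext) hslow

/-- **The crux IS its restriction to `L³`-fast times** — now unconditional
(`effSatBlowup_iff_fastTimesFatB` with the print fact discharged). -/
theorem effSatBlowup_iff_fastTimesFatB' : EffSatBlowup ↔ FastTimesFatB :=
  effSatBlowup_iff_fastTimesFatB parabolicConcentrationB_holds

/-- **On the Morrey-Type-I class the crux IS the rate statement** `MorreyTypeISlowB` — now unconditional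
(`effSatBlowupMTI_iff_morreyTypeISlowB` with the print fact discharged). -/
theorem effSatBlowupMTI_iff_morreyTypeISlowB' : EffSatBlowupMTI ↔ MorreyTypeISlowB :=
  effSatBlowupMTI_iff_morreyTypeISlowB parabolicConcentrationB_holds

/-- **Sup-Type-I frame blow-ups are Morrey-Type-I near `T`** (Barker–Prange 2020, remark p. 5: the pointwise
rate `√(T-t)|u| ≤ M'` gives their Morrey condition (1.7) with some `r₀ > 0` and a solution-dependent constant —
Seregin–Zajączkowski; here by the tree's UNIFORM Morrey bound `scaledEnergyBound_proof` of route
`TypeICertificateLadder`): a classical solution on `[0,T)`, Leray–Hopf from a rapidly decaying datum, with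
`‖u(t,x)‖ ≤ C/√(T-t)` near `T` (`IsTypeIBlowup u T`) satisfies `MorreyTypeINear u T`.  So the class of stub 2
of line `pace` contains the sup-Type-I blow-ups, on which stub 2 is the proved `l3Slow_of_typeI`.
[cite: BarkerPrange2020, (1.7) and remark p. 5 (arXiv:1812.09115)] -/
theorem morreyTypeINear_of_typeI {ν T : ℝ} (hν : 0 < ν) (hT : 0 < T)
    {u : ℝ → EuclideanSpace ℝ (Fin 3) → EuclideanSpace ℝ (Fin 3)} {p : ℝ → EuclideanSpace ℝ (Fin 3) → ℝ}
    (hcl : IsClassicalNSSolutionOn (Ico 0 T) ν 0 u p) (hLH : IsLerayHopfOn T ν 0 (u 0) u)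
    (hdec : HasRapidSpatialDecay (u 0)) (hTI : IsTypeIBlowup u T) : MorreyTypeINear u T := by
  obtain ⟨C, hC⟩ := hTI
  have hsν : 0 < Real.sqrt ν := Real.sqrt_pos.2 hν
  -- the rate in the certificate-ladder currency `√(T-t)‖u‖ ≤ C'√ν`
  set C' : ℝ := (|C| + 1) / Real.sqrt ν with hC'
  have hC'pos : 0 < C' := by positivity
  have hrate : ∀ᶠ t in 𝓝[<] T, ∀ x, Real.sqrt (T - t) * ‖u t x‖ ≤ C' * Real.sqrt ν := by
    have hlt : ∀ᶠ t in 𝓝[<] T, t < T := eventually_nhdsWithin_of_forall fun t ht => ht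
    filter_upwards [hC, hlt] with t ht htT x
    have hs : 0 < Real.sqrt (T - t) := Real.sqrt_pos.2 (sub_pos.2 htT)
    calc Real.sqrt (T - t) * ‖u t x‖ ≤ Real.sqrt (T - t) * (C / Real.sqrt (T - t)) :=
          mul_le_mul_of_nonneg_left (ht x) hs.le
      _ = C := by field_simp
      _ ≤ |C| + 1 := by linarith [le_abs_self C]
      _ = C' * Real.sqrt ν := by rw [hC']; field_simp
  obtain ⟨A, hA⟩ := scaledEnergyBound_proof C' hC'pos
  obtain ⟨r₀, hr₀, hmor⟩ := hA ν T hν hT u p hcl hLH hdec hrate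
  obtain ⟨l, hlT, hl⟩ := mem_nhdsLT_iff_exists_Ioo_subset.1 hmor
  -- constants: `M = max (A ν²) 0 + 1`, `r₁ = min r₀ (min √(T - l) √T)`
  set M : ℝ := max (A * ν ^ 2) 0 + 1 with hM
  have hMpos : 0 < M := by rw [hM]; positivity
  have hAM : A * ν ^ 2 ≤ M := by rw [hM]; linarith [le_max_left (A * ν ^ 2) 0]
  have hTl : 0 < T - l := sub_pos.2 hlT
  set r₁ : ℝ := min r₀ (min (Real.sqrt (T - l)) (Real.sqrt T)) with hr₁
  have hr₁pos : 0 < r₁ := lt_min hr₀ (lt_min (Real.sqrt_pos.2 hTl) (Real.sqrt_pos.2 hT))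
  refine ⟨M, hMpos, r₁, hr₁pos, fun x₀ r hr hrr₁ t htr htT => ?_⟩
  have hrr₀ : r ≤ r₀ := (hrr₁.trans_le (min_le_left _ _)).le
  have hr2l : r ^ 2 < T - l := by
    have h1 : r < Real.sqrt (T - l) := hrr₁.trans_le ((min_le_right _ _).trans (min_le_left _ _))
    nlinarith [Real.sq_sqrt hTl.le, Real.sqrt_nonneg (T - l)]
  have hr2T : r ^ 2 < T := by
    have h1 : r < Real.sqrt T := hrr₁.trans_le ((min_le_right _ _).trans (min_le_right _ _))
    nlinarith [Real.sq_sqrt hT.le, Real.sqrt_nonneg T]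
  have htl : t ∈ Ioo l T := ⟨by linarith, htT⟩
  have ht0 : 0 ≤ t := by linarith
  have hball := hl htl x₀ r hr hrr₀
  rw [inv_mul_le_iff₀ hr] at hball
  have hcont : Continuous (u t) := (hcl.contDiff_velocity ⟨ht0, htT⟩).continuous
  rw [typeIConc_lintegral_ball_enorm_pow_eq hcont x₀ r 2]
  refine ENNReal.ofReal_le_ofReal ?_
  calc ∫ x in ball x₀ r, ‖u t x‖ ^ 2 ≤ r * (A * ν ^ 2) := hball
    _ ≤ r * M := mul_le_mul_of_nonneg_left hAM hr.le
    _ = M * r := mul_comm _ _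

end Summit.NavierStokesRegularity.NavierStokesRegularity.Theorems.L3TimeExponentPincerStubParabolicConcentration

end
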